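import Mathlib
import HarnessLib
import HarnessLib.Audit
import Summits.CriticalPhenomena.PercolationContinuityZ3.Theorems.PercNearOneGluingNoHeavyLowerTailHexMSMatchAxisInsert

/-!
# Conjecture (MATCH), two dead classes with a singleton class, II: (MATCH), Δ-HEX, HEX-MS for "one axis plus one antipodal pair" (hp-7 gen 70)

Support file for crux `stmt-CriticalPhenomena-4575` (route `PercNearOneGluingNoHeavy`), hull-port seat `prim-hp-7` (generation 70);
`--supports stmt-CriticalPhenomena-4575`.  No `sorry`, no definition.  Memo: `run/shared/lean/prim/prim-hp-7/FROM-prim-hp-7-g70-MS-EQUALITY.md` §2.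

* `two_mul_card_add_two_le_card_biUnion_candidates`, `card_le_card_biUnion_candidates_of_axis_insert` — **Hall's condition for
  `A = cl(P ∪ {q})`, `P ⊆ dead_ℓ`, `q ∈ dead_{ℓ+1}`**: the same-label candidates `ΔP ∪ co ΔP` number `2 #ΔP ≥ 2 #P` (Marica–Schönheim), which is
  `≥ #A = 2 #P + 2` unless `P` is MS-tight; then `P` has a pivot (`TwistedAD.exists_pivot_of_card_diffs_eq_card`), is a twisted product over it
  (`…HexMSMSEquality`), and part I adds a complementary pair of new candidates.
* `card_le_card_biUnion_candidates_of_axis_pair`, `matchHall_of_dead_axis_pair`, `deltaHexRel_of_dead_axis_pair`, `hexMSRel_of_dead_axis_pair`,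
  `hexMSAt_of_dead_axis_pair` — **(MATCH), Δ-HEX and HEX-MS hold for every antipodal instance whose dead members lie on one antipodal axis
  `{ℓ, ℓ+3}` except for one antipodal pair `{q, U \ q}` with `x q = ℓ + 1`** (gen 69 had: all dead members on one axis);
  `matchHall_of_dead_axis_pair'` — the same with `x q = ℓ + 5`, by the label reflection `x ↦ -x` (part I).  Hence a counterexample to (MATCH)/Δ-HEX/HEX-MS has, off every axis, at least two
  antipodal pairs of dead members.
-/

namespace Summit.CriticalPhenomena.PercolationContinuityZ3.Theorems

namespace GeneratedDonors

open Finset FinsetFamily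

variable {α : Type*} [DecidableEq α]

section AxisInsertHall

variable {U : Finset α} {𝒟 : Finset (Finset α)} {x : Finset α → ZMod 6}

/-- **Hall's condition for `cl(P ∪ {q})`, `P ⊆ dead_ℓ`, `q ∈ dead_{ℓ+1}` (two dead classes, the second a singleton).**
`2 #P + 2 ≤ #N(cl(P ∪ {q}))`: the same-label candidates `cl ΔP` number `2 #ΔP`; if `P` is not MS-tight this is already enough, and if it is,
`P` is a twisted product over a pivot (`TwistedAD.exists_pivot_of_card_diffs_eq_card`) and `exists_candidate_notMem_cl_diffs` adds a pair. -/
theorem two_mul_card_add_two_le_card_biUnion_candidates (hU : ∀ a ∈ 𝒟, a ⊆ U) (hco : ∀ a ∈ 𝒟, U \ a ∈ 𝒟)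
    (hanti : ∀ a ∈ 𝒟, x (U \ a) = x a + 3) {P : Finset (Finset α)} (hP : P ⊆ dead U 𝒟 x) {ℓ : ZMod 6}
    (hPlab : ∀ p ∈ P, x p = ℓ) {q : Finset α} (hq : q ∈ dead U 𝒟 x) (hqlab : x q = ℓ + 1) :
    2 * #P + 2 ≤ #((insert q P ∪ (insert q P).image fun f => U \ f).biUnion (candidates 𝒟 x)) := by
  classical
  have hPD : ∀ p ∈ P, p ∈ 𝒟 := fun p hp => (mem_filter.mp (hP hp)).1
  have hPU : ∀ p ∈ P, p ⊆ U := fun p hp => hU p (hPD p hp)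
  have hqD : q ∈ 𝒟 := (mem_filter.mp hq).1
  have hqU : q ⊆ U := hU q hqD
  set A := insert q P ∪ (insert q P).image fun f => U \ f with hA
  set N := A.biUnion (candidates 𝒟 x) with hN
  have hcc : ∀ a : Finset α, a ⊆ U → U \ (U \ a) = a := fun a ha => Finset.sdiff_sdiff_eq_self ha
  have hPA : ∀ p ∈ P, p ∈ A := fun p hp => mem_union_left _ (mem_insert_of_mem hp)
  have hqA : q ∈ A := mem_union_left _ (mem_insert_self q P)
  have hcoA : ∀ s ∈ insert q P, U \ s ∈ A := fun s hs => mem_union_right _ (mem_image_of_mem _ hs)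
  -- the same-label candidates
  set X := (P \\ P) ∪ (P \\ P).image (fun z => U \ z) with hX
  have hXN : X ⊆ N := by
    intro e he
    rw [hX, mem_union, mem_image] at he
    rcases he with he | ⟨e', he', rfl⟩
    · obtain ⟨b, hb, b', hb', rfl⟩ := Finset.mem_diffs.mp he
      exact mem_biUnion.mpr ⟨b, hPA b hb, (sdiff_mem_candidates_of_label_eq hU hco hanti (hP hb) (hP hb')
        (by rw [hPlab b hb, hPlab b' hb'])).1⟩
    · obtain ⟨b', hb', b, hb, rfl⟩ := Finset.mem_diffs.mp he'
      exact mem_biUnion.mpr ⟨b, hPA b hb, (sdiff_mem_candidates_of_label_eq hU hco hanti (hP hb) (hP hb')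
        (by rw [hPlab b hb, hPlab b' hb'])).2⟩
  have hint : ∀ f ∈ P, ∀ g ∈ P, (f ∩ g).Nonempty := fun f hf g hg =>
    inter_nonempty_of_dead_of_close (hP hf) (hPD g hg) (by rw [hPlab f hf, hPlab g hg]; exact Or.inl rfl)
  have hXcard : #X = 2 * #(P \\ P) := card_cl_diffs_eq_two_mul hPU hint
  have hMS := Finset.card_le_card_diffs P
  by_cases ht : #(P \\ P) = #P
  · rcases P.eq_empty_or_nonempty with hP0 | hPne
    · -- `P = ∅`: the candidates `∅`, `U` of `q`
      have h0 : (∅ : Finset α) ∉ 𝒟 := empty_notMem_of_dead hU hco hanti hq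
      have hUn : U ∉ 𝒟 := fun h => h0 (by have := hco U h; rwa [Finset.sdiff_self] at this)
      have kfar : ∀ s : ZMod 6, ¬ Close s (s + 3) := by decide
      have hfar : ¬ Close (x q) (x (U \ q)) := by rw [hanti q hqD]; exact kfar _
      have h1 : ∅ ∈ candidates 𝒟 x q := by
        unfold candidates
        exact mem_sdiff.mpr ⟨mem_farProducts.mpr ⟨U \ q, hco q hqD, hfar, Or.inl (inter_sdiff_self q U).symm⟩, h0⟩
      have h2 : U ∈ candidates 𝒟 x q := by
        unfold candidates
        exact mem_sdiff.mpr ⟨mem_farProducts.mpr ⟨U \ q, hco q hqD, hfar,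
          Or.inr (by rw [union_sdiff_of_subset hqU])⟩, hUn⟩
      have hne : (∅ : Finset α) ≠ U := by
        intro h
        obtain ⟨i, hi⟩ := inter_nonempty_of_dead_of_close hq hqD (Or.inl rfl)
        have : i ∈ U := hqU (mem_inter.mp hi).1
        rw [← h] at this; exact notMem_empty i this
      have hsub : ({∅, U} : Finset (Finset α)) ⊆ N := by
        intro e he
        rw [mem_insert, mem_singleton] at he
        rcases he with rfl | rfl
        · exact mem_biUnion.mpr ⟨q, hqA, h1⟩
        · exact mem_biUnion.mpr ⟨q, hqA, h2⟩
      have := card_le_card hsub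
      rw [card_pair hne] at this
      rw [hP0, card_empty]; omega
    · -- `P` tight and nonempty: pivot and one new pair of candidates
      obtain ⟨c, hcP, hpiv⟩ := TwistedAD.exists_pivot_of_card_diffs_eq_card P ht hPne
      have htp := tp_mem_of_pivot ht.le hpiv
      have hsplit : ∀ e ∈ P \\ P, e ∩ c ∈ P.image (c \ ·) ∧ e \ c ∈ P.image (· \ c) :=
        fun e he => mem_diffs_pivot_split ht.le hpiv he
      have hqP : q ∉ P := fun h => by
        have := hPlab q h; rw [hqlab] at this
        exact add_one_ne_self ℓ this
      obtain ⟨w, hw, hw1, hw2⟩ := exists_candidate_notMem_cl_diffs hU hco hanti hP (fun p hp => Or.inl (hPlab p hp))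
        hq hqlab hqP hcP htp hsplit
      have hcD : c ∈ 𝒟 := hPD c hcP
      -- `w` and `U \ w` are in `N`
      have hwN : w ∈ N ∧ U \ w ∈ N ∧ w ⊆ U := by
        rcases hw with hw | hw
        · refine ⟨mem_biUnion.mpr ⟨q, hqA, hw⟩, mem_biUnion.mpr ⟨U \ q, hcoA q (mem_insert_self q P), ?_⟩,
            candidates_subset_ground hU hqD hw⟩
          rw [candidates_compl hU hco hanti hqD]; exact mem_image_of_mem _ hw
        · refine ⟨mem_biUnion.mpr ⟨c, hPA c hcP, hw⟩, mem_biUnion.mpr ⟨U \ c, hcoA c (mem_insert_of_mem hcP), ?_⟩,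
            candidates_subset_ground hU hcD hw⟩
          rw [candidates_compl hU hco hanti hcD]; exact mem_image_of_mem _ hw
      obtain ⟨hwN1, hwN2, hwU⟩ := hwN
      -- `U \ w ∉ X` (X is complement-closed), so the pair is new
      have hXU : ∀ e ∈ P \\ P, e ⊆ U := by
        intro e he; obtain ⟨f, hf, g, _, rfl⟩ := Finset.mem_diffs.mp he; exact sdiff_subset.trans (hPU f hf)
      have hcw : U \ w ∉ X := by
        intro h
        rw [hX, mem_union, mem_image] at h
        rcases h with h | ⟨e, he, hee⟩
        · exact hw2 (mem_image.mpr ⟨U \ w, h, hcc w hwU⟩)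
        · apply hw1
          have : e = w := by
            have h1 := congrArg (fun t => U \ t) hee
            simp only [hcc e (hXU e he), hcc w hwU] at h1
            exact h1
          rw [← this]; exact he
      have hwX : w ∉ X := fun h => by rw [hX, mem_union] at h; exact h.elim hw1 hw2
      have h1 := card_add_two_le_card_of_pair hXN hwN1 hwN2 hwX hcw (ne_compl_of_dead hU hq w)
      rw [hXcard, ht] at h1
      exact h1
  · -- `P` not tight: `#ΔP ≥ #P + 1`
    have h1 := card_le_card hXN
    rw [hXcard] at h1
    omega

/-- Hall's inequality for `A = cl(P ∪ {q})` in the usual form `#A ≤ #N(A)`. -/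
theorem card_le_card_biUnion_candidates_of_axis_insert (hU : ∀ a ∈ 𝒟, a ⊆ U) (hco : ∀ a ∈ 𝒟, U \ a ∈ 𝒟)
    (hanti : ∀ a ∈ 𝒟, x (U \ a) = x a + 3) {P : Finset (Finset α)} (hP : P ⊆ dead U 𝒟 x) {ℓ : ZMod 6}
    (hPlab : ∀ p ∈ P, x p = ℓ) {q : Finset α} (hq : q ∈ dead U 𝒟 x) (hqlab : x q = ℓ + 1) :
    #(insert q P ∪ (insert q P).image fun f => U \ f) ≤
      #((insert q P ∪ (insert q P).image fun f => U \ f).biUnion (candidates 𝒟 x)) := by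
  refine le_trans ?_ (two_mul_card_add_two_le_card_biUnion_candidates hU hco hanti hP hPlab hq hqlab)
  refine (card_union_le _ _).trans ?_
  have h1 := card_insert_le q P
  have h2 : #((insert q P).image fun f => U \ f) ≤ #(insert q P) := card_image_le
  omega

end AxisInsertHall

section AxisPair

/-! ### (MATCH), Δ-HEX and HEX-MS when the dead set lies on one axis plus one antipodal pair -/

variable {U : Finset α} {𝒟 : Finset (Finset α)} {x : Finset α → ZMod 6}

/-- **Hall for every family of dead members supported on one axis plus the pair `{q, U \ q}`** (`x q = ℓ + 1`, `q` dead). -/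
theorem card_le_card_biUnion_candidates_of_axis_pair (hU : ∀ a ∈ 𝒟, a ⊆ U) (hco : ∀ a ∈ 𝒟, U \ a ∈ 𝒟)
    (hanti : ∀ a ∈ 𝒟, x (U \ a) = x a + 3) (ℓ : ZMod 6) {q : Finset α} (hq : q ∈ dead U 𝒟 x) (hqlab : x q = ℓ + 1)
    {A : Finset (Finset α)} (hA : A ⊆ dead U 𝒟 x) (hlab : ∀ a ∈ A, x a = ℓ ∨ x a = ℓ + 3 ∨ a = q ∨ a = U \ q) :
    #A ≤ #(A.biUnion (candidates 𝒟 x)) := by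
  classical
  have hdeadD : ∀ a ∈ dead U 𝒟 x, a ∈ 𝒟 := fun a ha => (mem_filter.mp ha).1
  have hqD : q ∈ 𝒟 := hdeadD q hq
  have hqU : q ⊆ U := hU q hqD
  have hcc : ∀ a : Finset α, a ⊆ U → U \ (U \ a) = a := fun a ha => Finset.sdiff_sdiff_eq_self ha
  -- the complement-closed envelope
  set E : Finset (Finset α) := (dead U 𝒟 x).filter fun a => x a = ℓ ∨ x a = ℓ + 3 ∨ a = q ∨ a = U \ q with hE_def
  have hE : E ⊆ dead U 𝒟 x := filter_subset _ _
  have hEcl : ∀ a ∈ E, U \ a ∈ E := by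
    intro a ha
    rw [hE_def, mem_filter] at ha ⊢
    refine ⟨compl_mem_dead hU hco ha.1, ?_⟩
    rcases ha.2 with h | h | h | h
    · right; left; rw [hanti a (hdeadD a ha.1), h]
    · left; rw [hanti a (hdeadD a ha.1), h]; exact add_three_add_three ℓ
    · right; right; right; rw [h]
    · right; right; left; rw [h, hcc q hqU]
  have hAE : A ⊆ E := fun a ha => by rw [hE_def, mem_filter]; exact ⟨hA ha, hlab a ha⟩
  refine card_le_card_biUnion_candidates_of_complClosed_family hU hco hanti hE hEcl ?_ hAE
  intro A' hA'E hA'cl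
  have hA'dead : A' ⊆ dead U 𝒟 x := fun a ha => hE (hA'E ha)
  have hA'D : ∀ a ∈ A', a ∈ 𝒟 := fun a ha => hdeadD a (hA'dead ha)
  by_cases hqA : q ∈ A'
  · -- `A' = cl (P' ∪ {q})` with `P'` the label-`ℓ` part
    set P' : Finset (Finset α) := A'.filter fun a => x a = ℓ with hP'
    have hP'dead : P' ⊆ dead U 𝒟 x := fun a ha => hA'dead (mem_filter.mp ha).1
    have hP'lab : ∀ p ∈ P', x p = ℓ := fun p hp => (mem_filter.mp hp).2
    have heq : A' = insert q P' ∪ (insert q P').image fun f => U \ f := by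
      ext a
      rw [mem_union, mem_insert, mem_image]
      constructor
      · intro ha
        rcases (mem_filter.mp (hA'E ha)).2 with h | h | h | h
        · exact Or.inl (Or.inr (mem_filter.mpr ⟨ha, h⟩))
        · refine Or.inr ⟨U \ a, mem_insert_of_mem (mem_filter.mpr ⟨hA'cl a ha, ?_⟩), hcc a (hU a (hA'D a ha))⟩
          rw [hanti a (hA'D a ha), h]; exact add_three_add_three ℓ
        · exact Or.inl (Or.inl h)
        · exact Or.inr ⟨q, mem_insert_self q P', h.symm⟩
      · rintro ((rfl | ha) | ⟨f, hf, rfl⟩)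
        · exact hqA
        · exact (mem_filter.mp ha).1
        · rcases mem_insert.mp hf with rfl | hf
          · exact hA'cl _ hqA
          · exact hA'cl f (mem_filter.mp hf).1
    rw [heq]
    exact card_le_card_biUnion_candidates_of_axis_insert hU hco hanti hP'dead hP'lab hq hqlab
  · -- `q ∉ A'`: then `U \ q ∉ A'` and `A'` lies on the axis
    have hcqA : U \ q ∉ A' := fun h => hqA (by have := hA'cl _ h; rwa [hcc q hqU] at this)
    refine card_le_card_biUnion_candidates_of_axis hU hco hanti ℓ hA'dead fun a ha => ?_
    rcases (mem_filter.mp (hA'E ha)).2 with h | h | h | h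
    · exact Or.inl h
    · exact Or.inr h
    · exact absurd ha (h ▸ hqA)
    · exact absurd ha (h ▸ hcqA)

/-- **(MATCH) when the dead set lies on one antipodal axis plus one antipodal pair.**  If every dead member other than `q`, `U \ q` carries a
label in `{ℓ, ℓ+3}`, where `q` is dead with `x q = ℓ + 1`, Conjecture (MATCH) holds for the instance. -/
theorem matchHall_of_dead_axis_pair (hU : ∀ a ∈ 𝒟, a ⊆ U) (hco : ∀ a ∈ 𝒟, U \ a ∈ 𝒟)
    (hanti : ∀ a ∈ 𝒟, x (U \ a) = x a + 3) (ℓ : ZMod 6) {q : Finset α} (hq : q ∈ dead U 𝒟 x) (hqlab : x q = ℓ + 1)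
    (hdead : ∀ s ∈ dead U 𝒟 x, x s = ℓ ∨ x s = ℓ + 3 ∨ s = q ∨ s = U \ q) : MatchHall U 𝒟 x :=
  fun _ hA => card_le_card_biUnion_candidates_of_axis_pair hU hco hanti ℓ hq hqlab hA fun a ha => hdead a (hA ha)

/-- **Δ-HEX when the dead set lies on one axis plus one antipodal pair.** -/
theorem deltaHexRel_of_dead_axis_pair (ℓ : ZMod 6) (q : Finset α)
    (hdead : (∀ a ∈ 𝒟, a ⊆ U) → (∀ a ∈ 𝒟, U \ a ∈ 𝒟) → (∀ a ∈ 𝒟, x (U \ a) = x a + 3) →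
      q ∈ dead U 𝒟 x ∧ x q = ℓ + 1 ∧ ∀ s ∈ dead U 𝒟 x, x s = ℓ ∨ x s = ℓ + 3 ∨ s = q ∨ s = U \ q) :
    DeltaHexRel U 𝒟 x := by
  intro hU hco hanti
  obtain ⟨hq, hqlab, hd⟩ := hdead hU hco hanti
  exact deltaHexRel_of_matchHall (matchHall_of_dead_axis_pair hU hco hanti ℓ hq hqlab hd) hU hco hanti

/-- **HEX-MS when the dead set lies on one axis plus one antipodal pair**: `#𝒟 ≤ 2 · #(gen 𝒟 x)`. -/
theorem hexMSRel_of_dead_axis_pair (ℓ : ZMod 6) (q : Finset α)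
    (hdead : (∀ a ∈ 𝒟, a ⊆ U) → (∀ a ∈ 𝒟, U \ a ∈ 𝒟) → (∀ a ∈ 𝒟, x (U \ a) = x a + 3) →
      q ∈ dead U 𝒟 x ∧ x q = ℓ + 1 ∧ ∀ s ∈ dead U 𝒟 x, x s = ℓ ∨ x s = ℓ + 3 ∨ s = q ∨ s = U \ q) :
    HexMSRel U 𝒟 x := by
  intro hU hco hanti
  have h1 := deltaHexRel_of_dead_axis_pair ℓ q hdead hU hco hanti
  have h2 := card_symGen_le U 𝒟 x
  omega

/-- **HEX-MS (full cube) when the dead set lies on one axis plus one antipodal pair.** -/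
theorem hexMSAt_of_dead_axis_pair {β : Type*} [Fintype β] [DecidableEq β] (𝒟 : Finset (Finset β)) (x : Finset β → ZMod 6)
    (ℓ : ZMod 6) {q : Finset β} (hq : q ∈ dead univ 𝒟 x) (hqlab : x q = ℓ + 1)
    (hdead : ∀ s ∈ dead univ 𝒟 x, x s = ℓ ∨ x s = ℓ + 3 ∨ s = q ∨ s = univ \ q) : HexMSAt 𝒟 x :=
  (hexMSRel_univ_iff 𝒟 x).mp (hexMSRel_of_dead_axis_pair ℓ q fun _ _ _ => ⟨hq, hqlab, hdead⟩)

end AxisPair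


section AxisPairReflected

variable {U : Finset α} {𝒟 : Finset (Finset α)} {x : Finset α → ZMod 6}

/-- **(MATCH) for one axis plus a pair at `ℓ + 5`** (the singleton in the LOWER adjacent class), by reflection. -/
theorem matchHall_of_dead_axis_pair' (hU : ∀ a ∈ 𝒟, a ⊆ U) (hco : ∀ a ∈ 𝒟, U \ a ∈ 𝒟)
    (hanti : ∀ a ∈ 𝒟, x (U \ a) = x a + 3) (ℓ : ZMod 6) {q : Finset α} (hq : q ∈ dead U 𝒟 x) (hqlab : x q = ℓ + 5)
    (hdead : ∀ s ∈ dead U 𝒟 x, x s = ℓ ∨ x s = ℓ + 3 ∨ s = q ∨ s = U \ q) : MatchHall U 𝒟 x := by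
  rw [← matchHall_neg_iff]
  have hanti' : ∀ a ∈ 𝒟, (fun s => -x s) (U \ a) = (fun s => -x s) a + 3 := by
    intro a ha; show -x (U \ a) = -x a + 3; rw [hanti a ha]; exact neg_add_three (x a)
  have h5 : ∀ s : ZMod 6, -(s + 5) = -s + 1 := by decide
  have h3 : ∀ s : ZMod 6, -(s + 3) = -s + 3 := by decide
  refine matchHall_of_dead_axis_pair hU hco hanti' (-ℓ) (q := q) (by rw [dead_neg]; exact hq)
    (by simp only [hqlab, h5]) fun s hs => ?_
  rw [dead_neg] at hs
  rcases hdead s hs with h | h | h | h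
  · exact Or.inl (by simp only [h])
  · exact Or.inr (Or.inl (by simp only [h, h3]))
  · exact Or.inr (Or.inr (Or.inl h))
  · exact Or.inr (Or.inr (Or.inr h))

end AxisPairReflected

end GeneratedDonors

end Summit.CriticalPhenomena.PercolationContinuityZ3.Theorems
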